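import Summits.AtomisticToContinuum.Crystallization.Theorems.FrustratedLawDichotomyStrainedPatchHomEntrySym
import Summits.AtomisticToContinuum.Crystallization.Theorems.FrustratedLawDichotomyStrainedPatchHomLeafTableFcc

/-!
# SYMMETRY REDUCTION of the fcc half of `(H)`, part 2a (KIT): coordinate REFLECTIONS `F_i`, conjugation `F_i U F_i`, the label involution
# `flipLab`, and the transfer of the two disjuncts (box sum by the TAIL ARGUMENT, prune disjunct by `pruneFcc_comp`)

decomp-a2c hand-1 g21 (crux `AperiodicFrustratedLawGap`, stmt-AtomisticToContinuum-27623; CERT-DESIGN-g44 §0).  Conjugating a self-adjoint `U` by the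
coordinate reflection `F_i` (flip the sign of coordinate `i`) multiplies `u_ab` by `ε_a ε_b`.  Unlike a coordinate permutation (`…HomEntrySym`), `F_i`
does NOT permute the fcc frame: `F_i f_j = f_j + 2 f_i − (f₀ + f₁ + f₂)` (`j ≠ i`), `F_i f_i = f_i` — an integer involution `flipLab i` of the labels which does
not preserve the label box `[−7,7]³`.  The box sum is nevertheless invariant by the TAIL ARGUMENT: a non-zero label outside the box has fcc norm
`n_b ≥ 43 ≥ 36`, hence is far (`…HomLeafTableFcc.far_of_nb`, needs `‖V − 1‖ ≤ 1/4`), and `W₄₅ = 0` beyond `9/2` (`effPot45_eq_far`); `n_b` is flip-invariant.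

* §1 generic conjugation lemmas for any linear isometry `P` (pointwise form, self-adjointness, positivity, `‖PUP⁻¹ − 1‖ ≤ ‖U − 1‖`);
* §2 `flipIso i` (Mathlib's reflection in the hyperplane `(ℝ ∙ e_i)ᗮ`), its coordinates, ★ entries of the conjugate `u_ab ↦ ε_a ε_b u_ab`, frame action;
* §3 `flipLab`, `n_{flipLab b} = n_b`, non-zero labels outside the box have `n_b ≥ 43`, ★ `boxSum_flip` (tail argument), ★ `dichotomy_of_flip` (transfer).

Sequel: `…HomEntrySign` (the ×24 fundamental-domain reduction and the certificate theorems).  0 sorry; standard axioms; no instances / notation / `#eval`.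
`--supports stmt-AtomisticToContinuum-27623`.
-/

namespace Summit.AtomisticToContinuum.Crystallization.Theorems.FrustratedLawDichotomyStrainedPatchHomEntrySignKit

open scoped BigOperators RealInnerProductSpace
open Literature.Analysis.ValidatedNumerics.Numerics
open Summit.AtomisticToContinuum.Crystallization.Theorems.ChargedEnergyGapNegative (E3)
open Summit.AtomisticToContinuum.Crystallization.Theorems.FrustratedLawDichotomySchurCut (effPot w₄₅ ω₄)
open Summit.AtomisticToContinuum.Crystallization.Theorems.FrustratedLawDichotomyAveragingRuleTightFree (TightNearCap BadNearCap)
open Summit.AtomisticToContinuum.Crystallization.Theorems.FrustratedLawDichotomyExemptAbsorption (ExemptNear)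
open Summit.AtomisticToContinuum.Crystallization.Theorems.FrustratedLawDichotomyStrainedPatchHomSplit
open Summit.AtomisticToContinuum.Crystallization.Theorems.FrustratedLawDichotomyStrainedPatchHomPolar (latPt_comp)
open Summit.AtomisticToContinuum.Crystallization.Theorems.FrustratedLawDichotomyStrainedPatchHomIsometry (pruneFcc_comp)
open Summit.AtomisticToContinuum.Crystallization.Theorems.FrustratedLawDichotomyStrainedPatchHomTermCalculus (effPot45_eq_far)
open Summit.AtomisticToContinuum.Crystallization.Theorems.FrustratedLawDichotomyStrainedPatchHomLeafTableCheck (nbZ norm_sq_fccComb far_of_nb)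
open Summit.AtomisticToContinuum.Crystallization.Theorems.FrustratedLawDichotomyStrainedPatchHomPrunedPolar (homFloor_of_prunedBoxSums_selfAdjoint)
open Summit.AtomisticToContinuum.Crystallization.Theorems.FrustratedLawDichotomyStrainedPatchHomCertTree (CertTree treeOK treeOK_sound)
open Summit.AtomisticToContinuum.Crystallization.Theorems.FrustratedLawDichotomyStrainedPatchHomEntryGram
open Summit.AtomisticToContinuum.Crystallization.Theorems.FrustratedLawDichotomyStrainedPatchHomEntryGramHcp (rootCH rootWH)
open Summit.AtomisticToContinuum.Crystallization.Theorems.FrustratedLawDichotomyStrainedPatchHomEntryFitHcp (entryLeafOKH2 entryLeafOKH2_sound)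
open Summit.AtomisticToContinuum.Crystallization.Theorems.FrustratedLawDichotomyStrainedPatchHomEntryTable (muRec)
open Summit.AtomisticToContinuum.Crystallization.Theorems.FrustratedLawDichotomyStrainedPatchHomEntrySearch
open Summit.AtomisticToContinuum.Crystallization.Theorems.FrustratedLawDichotomyStrainedPatchHomEntrySym
open Literature.Barriers.AtomisticToContinuum.FlatleyTheil2015 (fccVec)

/-! ## §1. Conjugation by an arbitrary linear isometry -/

/-- Pointwise form of `P ∘ U ∘ P⁻¹`. [formal bookkeeping] -/
theorem conjIso_apply (P : E3 ≃ₗᵢ[ℝ] E3) (U : E3 →L[ℝ] E3) (w : E3) :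
    ((P : E3 →L[ℝ] E3).comp (U.comp (P.symm : E3 →L[ℝ] E3))) w = P (U (P.symm w)) := rfl

/-- `U w = P⁻¹ ((P U P⁻¹) (P w))`. [formal bookkeeping] -/
theorem apply_eq_symm_conjIso (P : E3 ≃ₗᵢ[ℝ] E3) (U : E3 →L[ℝ] E3) (w : E3) :
    U w = P.symm (((P : E3 →L[ℝ] E3).comp (U.comp (P.symm : E3 →L[ℝ] E3))) (P w)) := by
  rw [conjIso_apply, LinearIsometryEquiv.symm_apply_apply, LinearIsometryEquiv.symm_apply_apply]

/-- Self-adjointness transfers to the conjugate. [folklore] -/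
theorem conjIso_selfAdjoint (P : E3 ≃ₗᵢ[ℝ] E3) {U : E3 →L[ℝ] E3} (hsa : ∀ v w : E3, ⟪U v, w⟫ = ⟪v, U w⟫) (v w : E3) :
    ⟪((P : E3 →L[ℝ] E3).comp (U.comp (P.symm : E3 →L[ℝ] E3))) v, w⟫ = ⟪v, ((P : E3 →L[ℝ] E3).comp (U.comp (P.symm : E3 →L[ℝ] E3))) w⟫ := by
  rw [conjIso_apply, conjIso_apply]
  have h1 : ⟪P (U (P.symm v)), w⟫ = ⟪U (P.symm v), P.symm w⟫ := by
    rw [← LinearIsometryEquiv.inner_map_map P (U (P.symm v)) (P.symm w), LinearIsometryEquiv.apply_symm_apply]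
  have h2 : ⟪v, P (U (P.symm w))⟫ = ⟪P.symm v, U (P.symm w)⟫ := by
    rw [← LinearIsometryEquiv.inner_map_map P (P.symm v) (U (P.symm w)), LinearIsometryEquiv.apply_symm_apply]
  rw [h1, h2, hsa]

/-- Positivity transfers to the conjugate. [folklore] -/
theorem conjIso_pos (P : E3 ≃ₗᵢ[ℝ] E3) {U : E3 →L[ℝ] E3} (hpos : ∀ w : E3, 0 ≤ ⟪w, U w⟫) (w : E3) :
    0 ≤ ⟪w, ((P : E3 →L[ℝ] E3).comp (U.comp (P.symm : E3 →L[ℝ] E3))) w⟫ := by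
  rw [conjIso_apply]
  have e : ⟪w, P (U (P.symm w))⟫ = ⟪P.symm w, U (P.symm w)⟫ := by
    rw [← LinearIsometryEquiv.inner_map_map P (P.symm w) (U (P.symm w)), LinearIsometryEquiv.apply_symm_apply]
  rw [e]
  exact hpos _

/-- `‖P U P⁻¹ − 1‖ ≤ ‖U − 1‖`. [folklore] -/
theorem conjIso_norm_sub_one_le (P : E3 ≃ₗᵢ[ℝ] E3) (U : E3 →L[ℝ] E3) :
    ‖(P : E3 →L[ℝ] E3).comp (U.comp (P.symm : E3 →L[ℝ] E3)) - 1‖ ≤ ‖U - 1‖ := by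
  refine ContinuousLinearMap.opNorm_le_bound _ (norm_nonneg _) fun w => ?_
  have e : ((P : E3 →L[ℝ] E3).comp (U.comp (P.symm : E3 →L[ℝ] E3)) - 1) w = P ((U - 1) (P.symm w)) := by
    simp [map_sub]
  rw [e, LinearIsometryEquiv.norm_map]
  calc ‖(U - 1) (P.symm w)‖ ≤ ‖U - 1‖ * ‖P.symm w‖ := (U - 1).le_opNorm _
    _ = ‖U - 1‖ * ‖w‖ := by rw [LinearIsometryEquiv.norm_map]

/-! ## §2. The coordinate reflections -/

/-- `F_i`: flip the sign of coordinate `i` (reflection in the hyperplane `(ℝ ∙ e_i)ᗮ`). -/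
noncomputable def flipIso (i : Fin 3) : E3 ≃ₗᵢ[ℝ] E3 := ((ℝ ∙ EuclideanSpace.single i (1 : ℝ))ᗮ).reflection

/-- `F_i w = w − 2 w_i e_i`. [folklore] -/
theorem flipIso_eq (i : Fin 3) (w : E3) : flipIso i w = w - (2 * w i) • EuclideanSpace.single i (1 : ℝ) := by
  have hmem : w - w i • EuclideanSpace.single i (1 : ℝ) ∈ (ℝ ∙ EuclideanSpace.single i (1 : ℝ))ᗮ := by
    rw [Submodule.mem_orthogonal_singleton_iff_inner_right, inner_sub_right, real_inner_smul_right,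
      EuclideanSpace.inner_single_left, EuclideanSpace.inner_single_left]
    simp
  have hdec : w = (w - w i • EuclideanSpace.single i (1 : ℝ)) + w i • EuclideanSpace.single i (1 : ℝ) := by abel
  unfold flipIso
  conv_lhs => rw [hdec]
  rw [map_add, map_smul, Submodule.reflection_mem_subspace_eq_self hmem, Submodule.reflection_orthogonalComplement_singleton_eq_neg]
  rw [smul_neg, two_mul, add_smul]
  abel

/-- Coordinates of `F_i w`. [formal bookkeeping] -/
theorem flipIso_apply (i : Fin 3) (w : E3) (a : Fin 3) : flipIso i w a = if a = i then -w a else w a := by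
  rw [flipIso_eq]
  simp only [PiLp.sub_apply, PiLp.smul_apply, smul_eq_mul]
  split_ifs with h
  · subst h; simp; ring
  · simp [h]

/-- `F_i⁻¹ = F_i`. [formal bookkeeping] -/
theorem flipIso_symm (i : Fin 3) : (flipIso i).symm = flipIso i := by
  unfold flipIso; exact Submodule.reflection_symm

/-- `F_i e_b = ± e_b`. [formal bookkeeping] -/
theorem flipIso_single (i b : Fin 3) :
    flipIso i (EuclideanSpace.single b (1 : ℝ)) = (if b = i then (-1 : ℝ) else 1) • EuclideanSpace.single b (1 : ℝ) := by
  ext a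
  rw [flipIso_apply]
  simp only [PiLp.smul_apply, smul_eq_mul]
  by_cases hab : a = b
  · subst hab; simp
  · simp [hab]

/-- ★ Entries of the conjugate `F_i U F_i`: `u_ab ↦ ε_a ε_b u_ab` with `ε_i = −1`, `ε = 1` otherwise. [folklore] -/
theorem flip_entry (i : Fin 3) (U : E3 →L[ℝ] E3) (a b : Fin 3) :
    (((flipIso i : E3 →L[ℝ] E3).comp (U.comp ((flipIso i).symm : E3 →L[ℝ] E3))) (EuclideanSpace.single b (1 : ℝ))) a =
      (if a = i then (-1 : ℝ) else 1) * (if b = i then (-1 : ℝ) else 1) * (U (EuclideanSpace.single b (1 : ℝ))) a := by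
  rw [conjIso_apply, flipIso_symm, flipIso_single, map_smul, map_smul, PiLp.smul_apply, smul_eq_mul, flipIso_apply]
  split_ifs <;> ring

/-- Frame action: `F_i fⱼ = Σ_k M_kj f_k` with `(flipLab i b)_k = Σ_j M_kj b_j`; in coordinates `(F_i f_j)_a = ±(f_j)_a`. Stated as the vector identity
`F_i (Σ_j b_j f_j) = Σ_k (flipLab i b)_k f_k` below; here the label map. -/
def flipLab (i : Fin 3) (b : Fin 3 → ℤ) : Fin 3 → ℤ := fun k => if k = i then b 0 + b 1 + b 2 else b k - ((b 0 + b 1 + b 2) - b i)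

/-- `flipLab i` is an involution. [formal bookkeeping] -/
theorem flipLab_flipLab (i : Fin 3) (b : Fin 3 → ℤ) : flipLab i (flipLab i b) = b := by
  funext k
  fin_cases i <;> fin_cases k <;> simp [flipLab] <;> ring

/-- ★ `F_i (Σ_j b_j f_j) = Σ_k (flipLab i b)_k f_k`. [folklore] -/
theorem flipIso_sum_smul_fccVec (i : Fin 3) (b : Fin 3 → ℤ) :
    flipIso i (∑ j : Fin 3, ((b j : ℤ) : ℝ) • fccVec j) = ∑ k : Fin 3, ((flipLab i b k : ℤ) : ℝ) • fccVec k := by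
  ext a
  rw [flipIso_apply]
  fin_cases i <;> fin_cases a <;> simp [Fin.sum_univ_three, flipLab, fccVec_apply] <;> ring

/-- ★ Lattice points: `latPt U f b = F_i (latPt (F_i U F_i) f (flipLab i b))`. [folklore] -/
theorem latPt_eq_flip_conj (i : Fin 3) (U : E3 →L[ℝ] E3) (b : Fin 3 → ℤ) :
    latPt U fccVec b = (flipIso i).symm
      (latPt ((flipIso i : E3 →L[ℝ] E3).comp (U.comp ((flipIso i).symm : E3 →L[ℝ] E3))) fccVec (flipLab i b)) := by
  unfold latPt
  rw [apply_eq_symm_conjIso (flipIso i) U, flipIso_sum_smul_fccVec]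

/-- Composed form: `latPt U f b = latPt (F_i⁻¹ ∘ V) f (flipLab i b)`. [formal bookkeeping] -/
theorem latPt_eq_flip_comp (i : Fin 3) (U : E3 →L[ℝ] E3) (b : Fin 3 → ℤ) :
    latPt U fccVec b = latPt ((((flipIso i).symm : E3 ≃ₗᵢ[ℝ] E3) : E3 →L[ℝ] E3).comp
      ((flipIso i : E3 →L[ℝ] E3).comp (U.comp ((flipIso i).symm : E3 →L[ℝ] E3)))) fccVec (flipLab i b) := by
  rw [latPt_comp]; exact latPt_eq_flip_conj i U b

/-! ## §3. The tail argument and the transfer of the two disjuncts -/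

/-- The fcc norm is flip-invariant: `n_{flipLab i b} = n_b`. [folklore] -/
theorem nbZ_flipLab (i : Fin 3) (b : Fin 3 → ℤ) : nbZ (flipLab i b) = nbZ b := by
  fin_cases i <;> simp [nbZ, flipLab] <;> ring

/-- A non-zero label outside the box `[−7,7]³` has fcc norm `≥ 43` (`n_b ≥ ⅔ b_k²`). [folklore] -/
theorem nbZ_ge_of_not_mem_box {b : Fin 3 → ℤ} (hb : b ∉ (Fintype.piFinset fun _ : Fin 3 => Finset.Icc (-7 : ℤ) 7).filter (fun b => b ≠ 0))
    (h0 : b ≠ 0) : 43 ≤ nbZ b := by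
  simp only [Finset.mem_filter, Fintype.mem_piFinset, Finset.mem_Icc, ne_eq, not_and] at hb
  have hb' : ¬ ∀ a : Fin 3, -7 ≤ b a ∧ b a ≤ 7 := fun h => hb h h0
  obtain ⟨a, ha⟩ := not_forall.1 hb'
  have hsq : 64 ≤ b a * b a := by
    by_cases h7 : -7 ≤ b a
    · have h8 : 7 < b a := not_le.1 fun h => ha ⟨h7, h⟩
      nlinarith
    · have h8 : b a < -7 := not_le.1 h7
      nlinarith
  simp only [nbZ]
  fin_cases a
  · simp only [Fin.zero_eta, Fin.isValue] at hsq
    nlinarith [sq_nonneg (2 * b 0 + 3 * (b 1 + b 2)), sq_nonneg (b 1 - b 2)]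
  · simp only [Fin.mk_one, Fin.isValue] at hsq
    nlinarith [sq_nonneg (2 * b 1 + 3 * (b 0 + b 2)), sq_nonneg (b 0 - b 2)]
  · simp only [Fin.reduceFinMk, Fin.isValue] at hsq
    nlinarith [sq_nonneg (2 * b 2 + 3 * (b 0 + b 1)), sq_nonneg (b 0 - b 1)]

/-- The summand vanishes on non-zero labels outside the box (tail): far by `n_b ≥ 36` and `W₄₅ = 0` beyond `9/2`. [folklore] -/
theorem summand_eq_zero_of_not_mem_box {V : E3 →L[ℝ] E3} (hV : ‖V - 1‖ ≤ 1 / 4) {b : Fin 3 → ℤ}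
    (hb : b ∉ (Fintype.piFinset fun _ : Fin 3 => Finset.Icc (-7 : ℤ) 7).filter (fun b => b ≠ 0)) (h0 : b ≠ 0) :
    effPot w₄₅ ω₄ (3 / 400) ‖latPt V fccVec b‖ = 0 :=
  effPot45_eq_far (far_of_nb hV (by have := nbZ_ge_of_not_mem_box hb h0; omega))

/-- `flipLab i` as a permutation of the labels. -/
def flipLabEquiv (i : Fin 3) : (Fin 3 → ℤ) ≃ (Fin 3 → ℤ) := ⟨flipLab i, flipLab i, flipLab_flipLab i, flipLab_flipLab i⟩

/-- `flipLab i b = 0 ↔ b = 0`. [formal bookkeeping] -/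
theorem flipLab_eq_zero_iff (i : Fin 3) (b : Fin 3 → ℤ) : flipLab i b = 0 ↔ b = 0 := by
  constructor
  · intro h
    have := congrArg (flipLab i) h
    rw [flipLab_flipLab] at this
    rw [this]; funext k; simp [flipLab]
  · intro h; subst h; funext k; simp [flipLab]

/-- ★ **BOX SUM IS FLIP-INVARIANT** (tail argument): `Σ_{b ∈ box} W ‖latPt U f b‖ = Σ_{b ∈ box} W ‖latPt V f b‖`, `V = F_i U F_i`, for `‖U − 1‖ ≤ 1/4`.
[folklore] -/
theorem boxSum_flip (i : Fin 3) (U : E3 →L[ℝ] E3) (hU : ‖U - 1‖ ≤ 1 / 4) :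
    ∑ b ∈ (Fintype.piFinset fun _ : Fin 3 => Finset.Icc (-7 : ℤ) 7).filter (fun b => b ≠ 0), effPot w₄₅ ω₄ (3 / 400) ‖latPt U fccVec b‖ =
      ∑ b ∈ (Fintype.piFinset fun _ : Fin 3 => Finset.Icc (-7 : ℤ) 7).filter (fun b => b ≠ 0),
        effPot w₄₅ ω₄ (3 / 400) ‖latPt ((flipIso i : E3 →L[ℝ] E3).comp (U.comp ((flipIso i).symm : E3 →L[ℝ] E3))) fccVec b‖ := by
  classical
  set box := (Fintype.piFinset fun _ : Fin 3 => Finset.Icc (-7 : ℤ) 7).filter (fun b => b ≠ 0) with hbox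
  set V := (flipIso i : E3 →L[ℝ] E3).comp (U.comp ((flipIso i).symm : E3 →L[ℝ] E3)) with hVdef
  have hV : ‖V - 1‖ ≤ 1 / 4 := (conjIso_norm_sub_one_le (flipIso i) U).trans hU
  set g : (Fin 3 → ℤ) → ℝ := fun b => effPot w₄₅ ω₄ (3 / 400) ‖latPt V fccVec b‖ with hg
  have hne : ∀ b ∈ box, b ≠ 0 := fun b hb => (Finset.mem_filter.1 hb).2
  -- left side = Σ_{b ∈ box} g (flipLab i b) = Σ_{b' ∈ box.map flipLab} g b'
  have h1 : ∑ b ∈ box, effPot w₄₅ ω₄ (3 / 400) ‖latPt U fccVec b‖ = ∑ b ∈ box, g (flipLab i b) := by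
    refine Finset.sum_congr rfl fun b _ => ?_
    rw [hg, latPt_eq_flip_conj i U b, LinearIsometryEquiv.norm_map]
  have h2 : ∑ b ∈ box, g (flipLab i b) = ∑ b ∈ box.map (flipLabEquiv i).toEmbedding, g b := by
    rw [Finset.sum_map]; rfl
  -- both sums equal the sum over the union, by the tail argument
  have h3 : ∑ b ∈ box.map (flipLabEquiv i).toEmbedding, g b = ∑ b ∈ box ∪ box.map (flipLabEquiv i).toEmbedding, g b := by
    refine Finset.sum_subset Finset.subset_union_right fun b hbU hbn => ?_
    rcases Finset.mem_union.1 hbU with hb | hb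
    · -- b ∈ box, b ∉ box.map flipLab ⇒ flipLab b ∉ box ⇒ n_b = n_{flipLab b} ≥ 43
      have hfb : flipLab i b ∉ box := by
        intro h
        exact hbn (Finset.mem_map.2 ⟨flipLab i b, h, flipLab_flipLab i b⟩)
      have hfb0 : flipLab i b ≠ 0 := by rw [ne_eq, flipLab_eq_zero_iff]; exact hne b hb
      have h43 := nbZ_ge_of_not_mem_box hfb hfb0
      rw [nbZ_flipLab] at h43
      exact effPot45_eq_far (far_of_nb hV (by omega))
    · exact (hbn hb).elim
  have h4 : ∑ b ∈ box, g b = ∑ b ∈ box ∪ box.map (flipLabEquiv i).toEmbedding, g b := by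
    refine Finset.sum_subset Finset.subset_union_left fun b hbU hbn => ?_
    rcases Finset.mem_union.1 hbU with hb | hb
    · exact (hbn hb).elim
    · obtain ⟨b0, hb0, rfl⟩ := Finset.mem_map.1 hb
      have hne0 : flipLab i b0 ≠ 0 := by
        show (flipLabEquiv i).toEmbedding b0 ≠ 0
        change flipLab i b0 ≠ 0
        rw [ne_eq, flipLab_eq_zero_iff]; exact hne b0 hb0
      exact summand_eq_zero_of_not_mem_box hV hbn hne0
  rw [h1, h2, h3, ← h4]

/-- The realisation set of the `U`-fcc ball equals that of the `(F_i⁻¹ ∘ V)`-fcc ball (relabel by the involution `flipLab i`). [folklore] -/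
theorem range_set_eq_flip (i : Fin 3) (U : E3 →L[ℝ] E3) (ϱ : ℝ) (x0 : E3) :
    {x : E3 | dist x x0 ≤ ϱ ∧ ∃ a : Fin 3 → ℤ, x = x0 + latPt U fccVec a} =
      {x : E3 | dist x x0 ≤ ϱ ∧ ∃ a : Fin 3 → ℤ, x = x0 +
        latPt ((((flipIso i).symm : E3 ≃ₗᵢ[ℝ] E3) : E3 →L[ℝ] E3).comp
          ((flipIso i : E3 →L[ℝ] E3).comp (U.comp ((flipIso i).symm : E3 →L[ℝ] E3)))) fccVec a} := by
  ext x
  simp only [Set.mem_setOf_eq]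
  refine and_congr_right fun _ => ⟨?_, ?_⟩
  · rintro ⟨a, ha⟩
    exact ⟨flipLab i a, by rw [ha, latPt_eq_flip_comp i U a]⟩
  · rintro ⟨a, ha⟩
    refine ⟨flipLab i a, ?_⟩
    rw [latPt_eq_flip_comp i U (flipLab i a), flipLab_flipLab]
    exact ha

/-- ★ **TRANSFER**: the fcc dichotomy (prune ∨ `m`-floor) for `V = F_i U F_i` gives it for `U` (`‖U − 1‖ ≤ 1/4`). [folklore] -/
theorem dichotomy_of_flip (i : Fin 3) (U : E3 →L[ℝ] E3) (hU : ‖U - 1‖ ≤ 1 / 4) {m : ℝ}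
    (h : (∀ (M : ℕ) (z : Fin M → E3) (c : Fin M), Function.Injective z →
        Set.range z = {x : E3 | dist x (z c) ≤ 133 / 10 ∧ ∃ a : Fin 3 → ℤ,
          x = z c + latPt ((flipIso i : E3 →L[ℝ] E3).comp (U.comp ((flipIso i).symm : E3 →L[ℝ] E3))) fccVec a} →
        TightNearCap (9 / 5) (3 / 2) z c ∨ ExemptNear (9 / 5) ExRec z c ∨ BadNearCap (9 / 5) (3 / 2) z c) ∨
      m ≤ (∑ b ∈ (Fintype.piFinset fun _ : Fin 3 => Finset.Icc (-7 : ℤ) 7).filter (fun b => b ≠ 0),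
        effPot w₄₅ ω₄ (3 / 400) ‖latPt ((flipIso i : E3 →L[ℝ] E3).comp (U.comp ((flipIso i).symm : E3 →L[ℝ] E3))) fccVec b‖) / 2 -
        (-(7175 / 10000) + 3 / 400)) :
    (∀ (M : ℕ) (z : Fin M → E3) (c : Fin M), Function.Injective z →
        Set.range z = {x : E3 | dist x (z c) ≤ 133 / 10 ∧ ∃ a : Fin 3 → ℤ, x = z c + latPt U fccVec a} →
        TightNearCap (9 / 5) (3 / 2) z c ∨ ExemptNear (9 / 5) ExRec z c ∨ BadNearCap (9 / 5) (3 / 2) z c) ∨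
      m ≤ (∑ b ∈ (Fintype.piFinset fun _ : Fin 3 => Finset.Icc (-7 : ℤ) 7).filter (fun b => b ≠ 0),
        effPot w₄₅ ω₄ (3 / 400) ‖latPt U fccVec b‖) / 2 - (-(7175 / 10000) + 3 / 400) := by
  rcases h with h | h
  · left
    intro M z c hz hrange
    rw [range_set_eq_flip i U (133 / 10) (z c)] at hrange
    exact pruneFcc_comp (flipIso i).symm _ fccVec (133 / 10) h M z c hz hrange
  · right; rwa [boxSum_flip i U hU]

end Summit.AtomisticToContinuum.Crystallization.Theorems.FrustratedLawDichotomyStrainedPatchHomEntrySignKit
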